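import Literature.Probability.Percolation.TwoClusterExchange
import Summits.CriticalPhenomena.PercolationContinuityZ3.Theorems.PercNearOneGluingNoHeavyLowerTailTformPairExchange
import HarnessLib

/-!
# `NoHeavyLowerTail` (stmt-CriticalPhenomena-4575) — Kozma–Nitzan's Lemma 3(ii) for relay counts:
# the heaviness comparison of two vertices survives an avoidance event on the first vertex's cluster, with a multiplicative leak

Support file (prover `prim-hp-5`, hull-port cell, T-form calculus, gen 6; `--supports stmt-CriticalPhenomena-4575`).
No definitions, no named facts, no sorries.  `μ = prodBernoulli w`, relays `A`, level `j`, `N_v = |{a ∈ A : v ↔ a}|`,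
`U_v = {N_v > j}` (heavy), `L_v = {N_v ≤ j}` (light), `D = {x ↮ y}`, and for a vertex set `R` the avoidance event
`Q = {x ↮ R} = {∀ r ∈ R, x ↮ r}` (decreasing in the cluster of `x`).

Kozma–Nitzan (arXiv:2401.12397, Lemma 3(ii), p. 6): "if `P(a₁ ↔ b) < P(a₂ ↔ b) + δ` and `Q` is a decreasing event in the cluster of
`a₁` then `P(a₁ ↔ b, Q) < P(a₂ ↔ b, Q) + δ`" — proved from BHK given `{a₁ ↮ a₂}`.  Replacing "`↔ b`" by "heavy" (`N > j`, an
increasing event read on the cluster) and keeping the proof (BHK 2006 Thm 1.5 in the event form `twoClusterExchange` of the tree,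
given `D = {x ↮ y}`; the events `U_x ∩ L_y` and `L_x ∩ V_y` are of the two pure types and lie inside `D`) gives:

* `heavyLight_restrict_le` — `μ(D) · μ(Q ∩ U_x ∩ L_y) ≤ μ(D ∩ Q) · μ(U_x ∩ L_y)`   ("`x` heavy, `y` light" is pushed DOWN by `Q`);
* `lightHeavy_restrict_ge` — `μ(D ∩ Q) · μ(L_x ∩ U_y) ≤ μ(D) · μ(Q ∩ L_x ∩ U_y)`   ("`x` light, `y` heavy" is pushed UP by `Q`);
* `heavyComparison_restrict` — **`μ(D) · [μ(Q ∩ U_x ∩ L_y) − μ(Q ∩ L_x ∩ U_y)] ≤ μ(D ∩ Q) · [μ(U_x ∩ L_y) − μ(L_x ∩ U_y)]`**,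
  and `μ(U_x ∩ L_y) − μ(L_x ∩ U_y) = μ(U_x) − μ(U_y)`: the signed heaviness comparison of `x` against `y` can only move towards
  "`x` lighter" under an avoidance event on `C_x`, up to the factor `μ(Q | D) ≤ 1` — KN Lemma 3(ii) for relay counts.

Use (memo run/shared/lean/prim/prim-hp-5/OBSERVER-SET.md §14): this is the provable part of the HAIR / ADM-STAB statements
('admissibility of `x` for `y` survives `{x ↮ r}`'); what they need beyond it is recorded there.
-/

noncomputable section

namespace Summit.CriticalPhenomena.PercolationContinuityZ3.Theorems

open MeasureTheory Set Literature.Probability.LatticeModels Literature.Probability.Percolation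
open scoped Classical BigOperators

variable {V : Type*}

/-- Relay filters are monotone in the open edge cluster: `C_s(ω) ⊆ C_s(ω')` implies
`{a ∈ A : s ↔ a in ω} ⊆ {a ∈ A : s ↔ a in ω'}`. [folklore] -/
theorem filter_openConn_mono_of_openEdgeCluster_subset {ω ω' : BondConfig V} {s : V}
    (h : openEdgeCluster ω s ⊆ openEdgeCluster ω' s) (A : Finset V) :
    (A.filter fun a => ω ∈ openConn s a) ⊆ (A.filter fun a => ω' ∈ openConn s a) := by
  intro a ha
  rw [Finset.mem_filter] at ha ⊢
  refine ⟨ha.1, ?_⟩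
  change (openGraph ω').Reachable s a
  rw [reachable_iff_exists_mem_openEdgeCluster]
  rcases (reachable_iff_exists_mem_openEdgeCluster ω s a).1 ha.2 with h1 | ⟨e, he, hae⟩
  · exact Or.inl h1
  · exact Or.inr ⟨e, h he, hae⟩

variable [Fintype V]

/-- **"`x` heavy, `y` light" is pushed down by an avoidance event on `C_x`** (BHK 1.5, event form):
`μ(D) · μ(Q ∩ U_x ∩ L_y) ≤ μ(D ∩ Q) · μ(U_x ∩ L_y)` with `D = {x ↮ y}`, `Q = {x ↮ R}`.
[cite: VandenbergHaggstromKahn2005, Thm. 1.5 (p. 7)] [cite: KozmaNitzan2024, Lemma 1(ii) (pp. 5–6)] -/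
theorem heavyLight_restrict_le (w : Sym2 V → unitInterval) (A : Finset V) (x y : V) (hxy : x ≠ y) (R : Set V) (j : ℕ) :
    (prodBernoulli w).real (openConn x y)ᶜ *
        (prodBernoulli w).real ({ω : BondConfig V | ∀ r ∈ R, ω ∉ openConn x r} ∩
          ({ω : BondConfig V | j < (A.filter fun a => ω ∈ openConn x a).card} ∩
            {ω : BondConfig V | (A.filter fun a => ω ∈ openConn y a).card ≤ j})) ≤
      (prodBernoulli w).real ((openConn x y)ᶜ ∩ {ω : BondConfig V | ∀ r ∈ R, ω ∉ openConn x r}) *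
        (prodBernoulli w).real ({ω : BondConfig V | j < (A.filter fun a => ω ∈ openConn x a).card} ∩
          {ω : BondConfig V | (A.filter fun a => ω ∈ openConn y a).card ≤ j}) := by
  classical
  set μ := prodBernoulli w
  set E1 : Set (BondConfig V) := {ω : BondConfig V | j < (A.filter fun a => ω ∈ openConn x a).card} ∩
    {ω : BondConfig V | (A.filter fun a => ω ∈ openConn y a).card ≤ j} with hE1
  set Q : Set (BondConfig V) := {ω : BondConfig V | ∀ r ∈ R, ω ∉ openConn x r} with hQ
  -- `E1` is of type (+), `Q` of type (−); `univ` is of both types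
  have hE1t : ∀ ⦃ω ω' : BondConfig V⦄, openEdgeCluster ω x ⊆ openEdgeCluster ω' x →
      openEdgeCluster ω' y ⊆ openEdgeCluster ω y → ω ∈ E1 → ω' ∈ E1 := by
    intro ω ω' hx hy hω
    rcases hω with ⟨h1, h2⟩
    simp only [hE1, mem_inter_iff, mem_setOf_eq] at h1 h2 ⊢
    exact ⟨lt_of_lt_of_le h1 (Finset.card_le_card (filter_openConn_mono_of_openEdgeCluster_subset hx A)),
      le_trans (Finset.card_le_card (filter_openConn_mono_of_openEdgeCluster_subset hy A)) h2⟩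
  have hQt : ∀ ⦃ω ω' : BondConfig V⦄, openEdgeCluster ω' x ⊆ openEdgeCluster ω x →
      openEdgeCluster ω y ⊆ openEdgeCluster ω' y → ω ∈ Q → ω' ∈ Q := by
    intro ω ω' hx hy hω r hr
    exact typeMinus_not_openConn x y r hx hy (hω r hr)
  have hUp : ∀ ⦃ω ω' : BondConfig V⦄, openEdgeCluster ω x ⊆ openEdgeCluster ω' x →
      openEdgeCluster ω' y ⊆ openEdgeCluster ω y → ω ∈ (univ : Set (BondConfig V)) → ω' ∈ (univ : Set (BondConfig V)) :=
    fun _ _ _ _ _ => mem_univ _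
  have hUm : ∀ ⦃ω ω' : BondConfig V⦄, openEdgeCluster ω' x ⊆ openEdgeCluster ω x →
      openEdgeCluster ω y ⊆ openEdgeCluster ω' y → ω ∈ (univ : Set (BondConfig V)) → ω' ∈ (univ : Set (BondConfig V)) :=
    fun _ _ _ _ _ => mem_univ _
  have key := twoClusterExchange w hxy (A₁ := E1) (A₂ := univ) (B₁ := Q) (B₂ := univ) hE1t hUp hQt hUm
  simp only [inter_univ] at key
  -- `E1 ⊆ D`: if `x ↔ y` the two relay filters coincide
  have hsub : (openConn x y)ᶜ ∩ E1 = E1 := by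
    refine inter_eq_right.2 fun ω hω hxy' => ?_
    rcases hω with ⟨h1, h2⟩
    simp only [mem_setOf_eq] at h1 h2
    rw [filter_openConn_eq_of_mem hxy' A] at h1
    omega
  rw [hsub] at key
  calc μ.real (openConn x y)ᶜ * μ.real (Q ∩ E1)
      = μ.real ((openConn x y)ᶜ ∩ (E1 ∩ Q)) * μ.real (openConn x y)ᶜ := by
        rw [mul_comm, show (openConn x y)ᶜ ∩ (E1 ∩ Q) = Q ∩ E1 by
          rw [← inter_assoc, hsub, inter_comm]]
    _ ≤ μ.real E1 * μ.real ((openConn x y)ᶜ ∩ Q) := key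
    _ = μ.real ((openConn x y)ᶜ ∩ Q) * μ.real E1 := mul_comm _ _

/-- **"`x` light, `y` heavy" is pushed up by an avoidance event on `C_x`** (BHK 1.5, event form):
`μ(D ∩ Q) · μ(L_x ∩ U_y) ≤ μ(D) · μ(Q ∩ L_x ∩ U_y)` with `D = {x ↮ y}`, `Q = {x ↮ R}`.
[cite: VandenbergHaggstromKahn2005, Thm. 1.5 (p. 7)] [cite: KozmaNitzan2024, Lemma 1(i) (pp. 5–6)] -/
theorem lightHeavy_restrict_ge (w : Sym2 V → unitInterval) (A : Finset V) (x y : V) (hxy : x ≠ y) (R : Set V) (j : ℕ) :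
    (prodBernoulli w).real ((openConn x y)ᶜ ∩ {ω : BondConfig V | ∀ r ∈ R, ω ∉ openConn x r}) *
        (prodBernoulli w).real ({ω : BondConfig V | (A.filter fun a => ω ∈ openConn x a).card ≤ j} ∩
          {ω : BondConfig V | j < (A.filter fun a => ω ∈ openConn y a).card}) ≤
      (prodBernoulli w).real (openConn x y)ᶜ *
        (prodBernoulli w).real ({ω : BondConfig V | ∀ r ∈ R, ω ∉ openConn x r} ∩
          ({ω : BondConfig V | (A.filter fun a => ω ∈ openConn x a).card ≤ j} ∩
            {ω : BondConfig V | j < (A.filter fun a => ω ∈ openConn y a).card})) := by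
  classical
  set μ := prodBernoulli w
  set E2 : Set (BondConfig V) := {ω : BondConfig V | (A.filter fun a => ω ∈ openConn x a).card ≤ j} ∩
    {ω : BondConfig V | j < (A.filter fun a => ω ∈ openConn y a).card} with hE2
  set Q : Set (BondConfig V) := {ω : BondConfig V | ∀ r ∈ R, ω ∉ openConn x r} with hQ
  have hE2t : ∀ ⦃ω ω' : BondConfig V⦄, openEdgeCluster ω' x ⊆ openEdgeCluster ω x →
      openEdgeCluster ω y ⊆ openEdgeCluster ω' y → ω ∈ E2 → ω' ∈ E2 := by
    intro ω ω' hx hy hω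
    rcases hω with ⟨h1, h2⟩
    simp only [hE2, mem_inter_iff, mem_setOf_eq] at h1 h2 ⊢
    exact ⟨le_trans (Finset.card_le_card (filter_openConn_mono_of_openEdgeCluster_subset hx A)) h1,
      lt_of_lt_of_le h2 (Finset.card_le_card (filter_openConn_mono_of_openEdgeCluster_subset hy A))⟩
  have hQt : ∀ ⦃ω ω' : BondConfig V⦄, openEdgeCluster ω' x ⊆ openEdgeCluster ω x →
      openEdgeCluster ω y ⊆ openEdgeCluster ω' y → ω ∈ Q → ω' ∈ Q := by
    intro ω ω' hx hy hω r hr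
    exact typeMinus_not_openConn x y r hx hy (hω r hr)
  have hUp : ∀ ⦃ω ω' : BondConfig V⦄, openEdgeCluster ω x ⊆ openEdgeCluster ω' x →
      openEdgeCluster ω' y ⊆ openEdgeCluster ω y → ω ∈ (univ : Set (BondConfig V)) → ω' ∈ (univ : Set (BondConfig V)) :=
    fun _ _ _ _ _ => mem_univ _
  have key := twoClusterExchange w hxy (A₁ := univ) (A₂ := univ) (B₁ := E2) (B₂ := Q) hUp hUp hE2t hQt
  simp only [inter_univ, univ_inter] at key
  have hsub : (openConn x y)ᶜ ∩ E2 = E2 := by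
    refine inter_eq_right.2 fun ω hω hxy' => ?_
    rcases hω with ⟨h1, h2⟩
    simp only [mem_setOf_eq] at h1 h2
    rw [filter_openConn_eq_of_mem hxy' A] at h1
    omega
  rw [hsub] at key
  calc μ.real ((openConn x y)ᶜ ∩ Q) * μ.real E2 = μ.real E2 * μ.real ((openConn x y)ᶜ ∩ Q) := mul_comm _ _
    _ ≤ μ.real (openConn x y)ᶜ * μ.real ((openConn x y)ᶜ ∩ (E2 ∩ Q)) := key
    _ = μ.real (openConn x y)ᶜ * μ.real (Q ∩ E2) := by
        rw [show (openConn x y)ᶜ ∩ (E2 ∩ Q) = Q ∩ E2 by rw [← inter_assoc, hsub, inter_comm]]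

/-- **Kozma–Nitzan's Lemma 3(ii) for relay counts.**  For vertices `x ≠ y`, relays `A`, level `j`, and an avoidance event
`Q = {x ↮ R}` on the cluster of `x` (`D = {x ↮ y}`):
`μ(D) · [μ(Q ∩ U_x ∩ L_y) − μ(Q ∩ L_x ∩ U_y)] ≤ μ(D ∩ Q) · [μ(U_x ∩ L_y) − μ(L_x ∩ U_y)]`
(and `μ(U_x ∩ L_y) − μ(L_x ∩ U_y) = μ(U_x) − μ(U_y)`): restricting to `Q` moves the signed heaviness comparison of `x`
against `y` towards "`x` lighter", up to the factor `μ(Q | D) ≤ 1`.  Printed (connection version): "If `Q` is a decreasing event in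
the cluster of `a₁` then `P(a₁ ↔ b, Q) < P(a₂ ↔ b, Q) + δ`" whenever `P(a₁ ↔ b) < P(a₂ ↔ b) + δ`.
[cite: KozmaNitzan2024, Lemma 3(ii) (pp. 6–7)] [cite: VandenbergHaggstromKahn2005, Thm. 1.5 (p. 7)] -/
theorem heavyComparison_restrict (w : Sym2 V → unitInterval) (A : Finset V) (x y : V) (hxy : x ≠ y) (R : Set V) (j : ℕ) :
    (prodBernoulli w).real (openConn x y)ᶜ *
        ((prodBernoulli w).real ({ω : BondConfig V | ∀ r ∈ R, ω ∉ openConn x r} ∩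
            ({ω : BondConfig V | j < (A.filter fun a => ω ∈ openConn x a).card} ∩
              {ω : BondConfig V | (A.filter fun a => ω ∈ openConn y a).card ≤ j})) -
          (prodBernoulli w).real ({ω : BondConfig V | ∀ r ∈ R, ω ∉ openConn x r} ∩
            ({ω : BondConfig V | (A.filter fun a => ω ∈ openConn x a).card ≤ j} ∩
              {ω : BondConfig V | j < (A.filter fun a => ω ∈ openConn y a).card}))) ≤
      (prodBernoulli w).real ((openConn x y)ᶜ ∩ {ω : BondConfig V | ∀ r ∈ R, ω ∉ openConn x r}) *
        ((prodBernoulli w).real ({ω : BondConfig V | j < (A.filter fun a => ω ∈ openConn x a).card} ∩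
            {ω : BondConfig V | (A.filter fun a => ω ∈ openConn y a).card ≤ j}) -
          (prodBernoulli w).real ({ω : BondConfig V | (A.filter fun a => ω ∈ openConn x a).card ≤ j} ∩
            {ω : BondConfig V | j < (A.filter fun a => ω ∈ openConn y a).card})) := by
  have h1 := heavyLight_restrict_le w A x y hxy R j
  have h2 := lightHeavy_restrict_ge w A x y hxy R j
  nlinarith [h1, h2]

end Summit.CriticalPhenomena.PercolationContinuityZ3.Theorems

end
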